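import Mathlib.AlgebraicGeometry.Scheme
import HarnessLib

/-!
# [OURS · L1 W4.2] RECOGNITION (R4): the unit ENDS at an isolated stage — `π_m : C_m → C_{m−1}` is not surjective
# (topological kernel; crux chain w42, RECOGNITION-CUT (R4), hand res-D-pv-038)

OURS (cell `res-hironaka`, slot W4.2, crux `stmt-ResolutionOfSingularities-18506` / conjunct `-19249`; res-L1-w42-plan-1
RULINGS v3.12-3 (O) / v3.13-1 (AH) / v3.13-3: «hnorm + (R4)» → res-D-pv-038; `--supports … --as helper`, counted 0).
NOT a statement of the manuscript under review [claim: Hironaka2017, status: under-review] nor of [CossartJannsenSaito2020];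
AI plumbing, weaker than expert review.  Everything below is PROVED; no definition is introduced.

## What

Clause (v) of CJS Def. 6.38 («`π_m : C_m → C_{m−1}` is not surjective», typed as
`IsFundamentalUnit.not_surjective : ¬ (T.C j ⊆ (T.π j).base '' T.nearLocus N x (j + 1))`, `m = j + 1`; stub-1's
`Seg.UnitCentreDiscipline` clause 4) for the unit towers cut at ISOLATED stages reduces to a purely TOPOLOGICAL fact,
`not_subset_image_of_isolated_of_fibre_subsingleton`:

> Let `f : Y′ → Y` be a closed map, `C ⊆ Y` preirreducible with at least two points, `N′ ⊆ S ⊆ Y′` with `N′` closed,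
> and `x′ ∈ N′` over a point of `C` with closed image `{f x′}`, ISOLATED in `S` (`U ∩ S = {x′}` for an open `U`) and
> the ONLY point of `N′` over `f x′`.  Then `C ⊄ f(N′)`.

Proof: `N′ = {x′} ⊔ N″` with `N″ = N′ ∖ U` closed; if `C ⊆ f(N′) = {f x′} ∪ f(N″)` (two closed sets) then by
irreducibility `C ⊆ {f x′}` — impossible, `C` has two points — or `C ⊆ f(N″)`, giving a SECOND point of `N′` over
`f x′` — impossible by the fibre hypothesis.

INSTANTIATION (the consumer's, by name): `f = (T.π j).base` (a blow-up is proper, hence closed), `C = T.C j` (a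
permissible centre of the unit: an irreducible CURVE, so nontrivial), `N′ = T.nearLocus N x (j+1)` (closed: the fibre
over the closed point `x` cut by `{H ≥ H(x)}`, `H` upper semicontinuous), `S` = the Hilbert–Samuel locus of the stage
(`N′ ⊆ S`), `x′` = the terminal marked point (closed, `Iso` = `IsIsolatedInHSMaxLocus` gives `U`), and the fibre
hypothesis = ONE instance of RECOGNITION (R2) / P-b («at most one near point over the marked point `x_j ∈ C_j`»: the
relative directrix door at a CLOSED point of the CURVE centre, `e − dim T D = 1`; res-L1-w42-stub-2 / res-L1-s42-pv-1) BY
NAME.  So (R4) costs nothing beyond that single fibre statement.  Also a `Scheme` wrapper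
`not_subset_base_image_of_isolated_of_fibre_subsingleton`.

[cite: CossartJannsenSaito2020, Def. 6.38 (v), p. 105]
-/

set_option linter.dupNamespace false -- mandated namespace `…ResolutionOfSingularities.ResolutionOfSingularities…` of this single-conjunct summit

open CategoryTheory AlgebraicGeometry TopologicalSpace

universe u v

namespace Summit.ResolutionOfSingularities.ResolutionOfSingularities.Theorems.SigmaMaxModificationsCorridor3.Helpers

/-- **The topological kernel of (R4).**  `f : α → β` a closed map, `C ⊆ β` preirreducible and nontrivial,
`N′ ⊆ S ⊆ α` with `N′` closed; if `x′ ∈ N′` lies over a point of `C`, is the ONLY point of `N′` over `f x′`, `{f x′}` is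
closed and `x′` is isolated in `S`, then `C ⊄ f '' N′`. [folklore] -/
theorem not_subset_image_of_isolated_of_fibre_subsingleton {α : Type u} {β : Type v} [TopologicalSpace α]
    [TopologicalSpace β] {f : α → β} (hf : IsClosedMap f) {C : Set β} (hC : IsPreirreducible C)
    (hCnt : C.Nontrivial) {N' S : Set α} (hN' : IsClosed N') (hNS : N' ⊆ S)
    {x' : α} (hx' : x' ∈ N') (hfx' : f x' ∈ C) (hfib : (N' ∩ f ⁻¹' {f x'}).Subsingleton)
    (hcl : IsClosed ({f x'} : Set β)) (hiso : ∃ U : Set α, IsOpen U ∧ U ∩ S = {x'}) :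
    ¬ C ⊆ f '' N' := by
  intro hsub
  obtain ⟨U, hU, hUS⟩ := hiso
  have hxU : x' ∈ U := by
    have : x' ∈ U ∩ S := by rw [hUS]; exact Set.mem_singleton x'
    exact this.1
  -- `N′ = {x′} ∪ N″` with `N″ := N′ ∖ U` closed
  have hN'' : IsClosed (N' ∩ Uᶜ) := hN'.inter hU.isClosed_compl
  have hsplit : ∀ z ∈ N', z = x' ∨ z ∈ N' ∩ Uᶜ := by
    intro z hz
    by_cases hzU : z ∈ U
    · left
      have : z ∈ U ∩ S := ⟨hzU, hNS hz⟩
      rw [hUS] at this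
      exact this
    · exact Or.inr ⟨hz, hzU⟩
  -- `C ⊆ {f x′} ∪ f(N″)`, two closed sets
  have hcover : C ⊆ {f x'} ∪ f '' (N' ∩ Uᶜ) := by
    intro y hy
    obtain ⟨z, hz, rfl⟩ := hsub hy
    rcases hsplit z hz with rfl | hz'
    · exact Or.inl rfl
    · exact Or.inr ⟨z, hz', rfl⟩
  rcases (isPreirreducible_iff_isClosed_union_isClosed.1 hC) _ _ hcl (hf _ hN'') hcover with h | h
  · -- `C ⊆ {f x′}`: contradicts nontriviality
    obtain ⟨a, ha, b, hb, hab⟩ := hCnt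
    exact hab ((Set.mem_singleton_iff.1 (h ha)).trans (Set.mem_singleton_iff.1 (h hb)).symm)
  · -- `C ⊆ f(N″)`: a second point of `N′` over `f x′`
    obtain ⟨z, ⟨hzN, hzU⟩, hfz⟩ := h hfx'
    have hzx : z = x' := hfib ⟨hzN, hfz⟩ ⟨hx', rfl⟩
    exact hzU (hzx ▸ hxU)

/-- The same for a morphism of schemes `π : Y′ ⟶ Y` (read on underlying spaces; `π` closed, e.g. proper — a blow-up).
This is the shape of `IsFundamentalUnit.not_surjective` / `Seg.UnitCentreDiscipline` clause 4 (`m = j + 1`): with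
`C = T.C j`, `N′ = T.nearLocus N x (j+1)`, `S` the Hilbert–Samuel locus, `x′` the terminal (isolated) marked point and
the fibre hypothesis supplied by RECOGNITION (R2). [cite: CossartJannsenSaito2020, Def. 6.38 (v), p. 105] -/
theorem not_subset_base_image_of_isolated_of_fibre_subsingleton {Y' Y : Scheme.{u}} (π : Y' ⟶ Y)
    (hπ : IsClosedMap π.base) {C : Set Y} (hC : IsPreirreducible C) (hCnt : C.Nontrivial) {N' S : Set Y'}
    (hN' : IsClosed N') (hNS : N' ⊆ S) {x' : Y'} (hx' : x' ∈ N') (hπx' : π.base x' ∈ C)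
    (hfib : (N' ∩ π.base ⁻¹' {π.base x'}).Subsingleton) (hcl : IsClosed ({π.base x'} : Set Y))
    (hiso : ∃ U : Set Y', IsOpen U ∧ U ∩ S = {x'}) : ¬ C ⊆ π.base '' N' :=
  not_subset_image_of_isolated_of_fibre_subsingleton hπ hC hCnt hN' hNS hx' hπx' hfib hcl hiso

end Summit.ResolutionOfSingularities.ResolutionOfSingularities.Theorems.SigmaMaxModificationsCorridor3.Helpers
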